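import Literature.Barriers.AtomisticToContinuum.HardDiskGibbsMeasurability
import Mathlib.MeasureTheory.Measure.GiryMonad
import Mathlib.Probability.Kernel.Basic
import Mathlib.Analysis.SpecificLimits.Normed
import HarnessLib

/-!
# Hard-disc Gibbs kernels as measures: finiteness of the partition function, the DLR equation
# for functions, and the hard core almost surely (Richthammer 2007, §3.3 (3.1)–(3.2))

Third file of the bottom-up programme for `Richthammer2007_ineq35`
(`HardDiskTranslationInvarianceSteps.lean`). The tree's `weight z Λ Y A` (unnormalised
finite-volume weight of an EVENT `A`) and `gibbsKernel z Λ Y A = weight A / weight univ` are set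
functions; the printed proof constantly integrates FUNCTIONS against `γ_Λ(dX | X̄)` and uses
(3.1), `∫ μ(dX) f(X) = ∫ μ(dX̄) ∫ γ_Λ(dX|X̄) f(X)` for measurable `f ≥ 0`. This file provides:

* `weight_eq_sum_map_apply` — for measurable `A`, `weight z Λ Y A` is the value at `A` of the
  measure `∑_k (z^k/k!) · (λ_Λ^{⊗k}|_{hard core}) ∘ (x ↦ X_Λ X̄_{Λᶜ})⁻¹` on configurations, and
  `lintegral_sum_map` — its integral of a measurable `g ≥ 0` is
  `∑_k (z^k/k!) ∫_{Λ^k ∩ {hard core}} g(X_Λ X̄_{Λᶜ}) dx`;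
* `weight_univ_lt_top` — the partition function is finite for bounded `Λ`
  (`≤ exp(|z| λ²(Λ))`, [Richthammer2007, §3.3 Definition 2 and Lemma 4 (a)]), whence
  `gibbsKernel_univ : γ_Λ(𝒳 | X̄) = 1`;
* `exists_gibbs_kernel` — `X̄ ↦ γ_Λ(· | X̄)` is a Markov kernel (in Mathlib's sense) agreeing
  with `gibbsKernel` on events, with the integral formula above, and with `μ.bind γ_Λ = μ` for
  every Gibbs measure ("`γ_Λ` is a probability kernel … `μ ⊗ γ_Λ = μ`", [Richthammer2007, §3.3]);
* `IsGibbs.lintegral_eq` — **(3.1) for functions**;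
* `IsGibbs.measure_not_hardCoreIn`, `IsGibbs.ae_isHardCore` — **(3.2)**: a Gibbs measure of the
  hard-disc model gives full measure to hard-disc configurations.

No new definitions (the kernel is produced existentially; it is determined on events by
`gibbsKernel`).

## References

* [Richthammer2007] T. Richthammer, *Translation-invariance of two-dimensional Gibbsian point
  processes*, Comm. Math. Phys. 274 (2007) 81–122, arXiv:0706.3637: §3.3, Definition 2, (3.1),
  (3.2) (p. 7), Lemma 4 (a) (p. 7–8).
-/

noncomputable section

open MeasureTheory Set ProbabilityTheory
open scoped ENNReal

namespace Literature.Barriers.AtomisticToContinuum.HardDisk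

open Literature.Analysis.FunctionSpaces

/-! ### The unnormalised finite-volume measure -/

/-- **`weight` is a measure on events.** For measurable `Λ` and `A`,
`weight z Λ X̄ A = ∑_k (z^k/k!) (λ_Λ^{⊗k}|_{x : hard core})({x | X_Λ X̄_{Λᶜ} ∈ A})`, i.e. the value
at `A` of the push-forward, summed over `k`, of Lebesgue measure on `Λ^k` restricted to the
hard-core event. [cite: Richthammer2007, §3.2–3.3 (pp. 6–7)] -/
theorem weight_eq_sum_map_apply (z : ℝ) {Λ : Set (EuclideanSpace ℝ (Fin 2))}
    (hΛ : MeasurableSet Λ) (Y : PointConfig (EuclideanSpace ℝ (Fin 2)))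
    {A : Set (PointConfig (EuclideanSpace ℝ (Fin 2)))} (hA : MeasurableSet A) :
    weight z Λ Y A = Measure.sum (fun k : ℕ => ENNReal.ofReal (z ^ k / (Nat.factorial k)) •
      ((Measure.pi fun _ : Fin k => (volume : Measure (EuclideanSpace ℝ (Fin 2))).restrict Λ).restrict
        {x | HardCoreIn Λ (superpose Λ x Y)}).map (fun x => superpose Λ x Y)) A := by
  rw [Measure.sum_apply _ hA]
  unfold weight
  refine tsum_congr fun k => ?_
  rw [Measure.smul_apply, smul_eq_mul, Measure.map_apply (measurable_superpose_left hΛ k Y) hA,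
    Measure.restrict_apply ((measurable_superpose_left hΛ k Y) hA),
    ← lintegral_indicator_one (((measurable_superpose_left hΛ k Y) hA).inter
      (measurableSet_hardCoreIn_superpose_left hΛ k Y))]
  rfl

/-- **Integration against the unnormalised finite-volume measure**: for measurable `g ≥ 0`,
`∫ g d(∑_k …) = ∑_k (z^k/k!) ∫_{Λ^k ∩ {hard core}} g(X_Λ X̄_{Λᶜ}) dx` — the hard-disc version of
`∫ ν_Λ(dX|X̄) e^{-H_Λ(X)} z^{#X_Λ} g(X)` (up to the factor `e^{-λ²(Λ)}`).
[cite: Richthammer2007, §3.2–3.3 (pp. 6–7)] -/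
theorem lintegral_sum_map (z : ℝ) {Λ : Set (EuclideanSpace ℝ (Fin 2))}
    (hΛ : MeasurableSet Λ) (Y : PointConfig (EuclideanSpace ℝ (Fin 2)))
    {g : PointConfig (EuclideanSpace ℝ (Fin 2)) → ℝ≥0∞} (hg : Measurable g) :
    ∫⁻ X, g X ∂(Measure.sum (fun k : ℕ => ENNReal.ofReal (z ^ k / (Nat.factorial k)) •
      ((Measure.pi fun _ : Fin k => (volume : Measure (EuclideanSpace ℝ (Fin 2))).restrict Λ).restrict
        {x | HardCoreIn Λ (superpose Λ x Y)}).map (fun x => superpose Λ x Y))) =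
      ∑' k : ℕ, ENNReal.ofReal (z ^ k / (Nat.factorial k)) *
        ∫⁻ x in {x | HardCoreIn Λ (superpose Λ x Y)}, g (superpose Λ x Y)
          ∂(Measure.pi fun _ : Fin k => (volume : Measure (EuclideanSpace ℝ (Fin 2))).restrict Λ) := by
  rw [lintegral_sum_measure]
  refine tsum_congr fun k => ?_
  rw [lintegral_smul_measure, smul_eq_mul, lintegral_map hg (measurable_superpose_left hΛ k Y)]

/-! ### Finiteness of the partition function -/

/-- Total mass of `λ_Λ^{⊗k}`: `λ²(Λ)^k`. [folklore] -/
theorem pi_restrict_univ (Λ : Set (EuclideanSpace ℝ (Fin 2))) (k : ℕ) :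
    (Measure.pi fun _ : Fin k => (volume : Measure (EuclideanSpace ℝ (Fin 2))).restrict Λ) univ =
      volume Λ ^ k := by
  rw [Measure.pi_univ]
  simp [Finset.prod_const, Finset.card_univ, Fintype.card_fin]

/-- The `k`-th term of the partition function is at most `(|z|^k/k!) λ²(Λ)^k`.
[cite: Richthammer2007, §3.3 Definition 2 (p. 7)] -/
theorem weight_term_le (z : ℝ) (Λ : Set (EuclideanSpace ℝ (Fin 2)))
    (Y : PointConfig (EuclideanSpace ℝ (Fin 2))) (A : Set (PointConfig (EuclideanSpace ℝ (Fin 2))))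
    (k : ℕ) :
    ENNReal.ofReal (z ^ k / (Nat.factorial k)) *
        ∫⁻ x : Fin k → EuclideanSpace ℝ (Fin 2),
          (A ∩ {X | HardCoreIn Λ X}).indicator 1 (superpose Λ x Y)
            ∂(Measure.pi fun _ : Fin k => (volume : Measure (EuclideanSpace ℝ (Fin 2))).restrict Λ) ≤
      ENNReal.ofReal (|z| ^ k / (Nat.factorial k)) * volume Λ ^ k := by
  refine mul_le_mul' (ENNReal.ofReal_le_ofReal (div_le_div_of_nonneg_right ?_ (by positivity))) ?_
  · rw [← abs_pow]; exact le_abs_self _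
  · calc ∫⁻ x : Fin k → EuclideanSpace ℝ (Fin 2),
          (A ∩ {X | HardCoreIn Λ X}).indicator 1 (superpose Λ x Y)
            ∂(Measure.pi fun _ : Fin k => (volume : Measure (EuclideanSpace ℝ (Fin 2))).restrict Λ)
        ≤ ∫⁻ _x : Fin k → EuclideanSpace ℝ (Fin 2), 1
            ∂(Measure.pi fun _ : Fin k => (volume : Measure (EuclideanSpace ℝ (Fin 2))).restrict Λ) :=
          lintegral_mono fun x => Set.indicator_le_self _ _ _
      _ = volume Λ ^ k := by rw [lintegral_one, pi_restrict_univ]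

/-- **The partition function of a bounded volume is finite**:
`weight z Λ X̄ A ≤ ∑_k (|z|^k/k!) λ²(Λ)^k = exp(|z| λ²(Λ)) < ∞` for every real `z`, bounded `Λ`,
boundary condition `X̄` and event `A` ("by definition it is finite", here because all hard-core
energies are nonnegative, Lemma 4 (a)). [cite: Richthammer2007, §3.3 Definition 2 and Lemma 4 (a) (pp. 7–8)] -/
theorem weight_lt_top (z : ℝ) {Λ : Set (EuclideanSpace ℝ (Fin 2))} (hΛb : Bornology.IsBounded Λ)
    (Y : PointConfig (EuclideanSpace ℝ (Fin 2))) (A : Set (PointConfig (EuclideanSpace ℝ (Fin 2)))) :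
    weight z Λ Y A < ⊤ := by
  have hfin : volume Λ ≠ ⊤ := hΛb.measure_lt_top.ne
  set L : ℝ := (volume Λ).toReal with hL
  have hvol : volume Λ = ENNReal.ofReal L := by rw [hL, ENNReal.ofReal_toReal hfin]
  have hterm : ∀ k : ℕ, ENNReal.ofReal (|z| ^ k / (Nat.factorial k)) * volume Λ ^ k =
      ENNReal.ofReal ((|z| * L) ^ k / (Nat.factorial k)) := fun k => by
    rw [hvol, ← ENNReal.ofReal_pow ENNReal.toReal_nonneg, ← ENNReal.ofReal_mul (by positivity)]
    congr 1
    rw [mul_pow]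
    ring
  calc weight z Λ Y A
      ≤ ∑' k : ℕ, ENNReal.ofReal (|z| ^ k / (Nat.factorial k)) * volume Λ ^ k :=
        ENNReal.tsum_le_tsum fun k => weight_term_le z Λ Y A k
    _ = ∑' k : ℕ, ENNReal.ofReal ((|z| * L) ^ k / (Nat.factorial k)) := tsum_congr hterm
    _ = ENNReal.ofReal (∑' k : ℕ, (|z| * L) ^ k / (Nat.factorial k)) :=
        (ENNReal.ofReal_tsum_of_nonneg (fun k => by positivity)
          (Real.summable_pow_div_factorial _)).symm
    _ < ⊤ := ENNReal.ofReal_lt_top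

/-- The partition function is finite and nonzero: `weight z Λ X̄ 𝒳 ∈ [1, ∞[`.
[cite: Richthammer2007, §3.3 (p. 7)] -/
theorem weight_univ_ne_top (z : ℝ) {Λ : Set (EuclideanSpace ℝ (Fin 2))}
    (hΛb : Bornology.IsBounded Λ) (Y : PointConfig (EuclideanSpace ℝ (Fin 2))) :
    weight z Λ Y univ ≠ ⊤ :=
  (weight_lt_top z hΛb Y univ).ne

/-- The partition function is nonzero (the empty configuration contributes `1`).
[cite: Richthammer2007, §3.3 (p. 7)] -/
theorem weight_univ_ne_zero (z : ℝ) (Λ : Set (EuclideanSpace ℝ (Fin 2)))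
    (Y : PointConfig (EuclideanSpace ℝ (Fin 2))) : weight z Λ Y univ ≠ 0 :=
  (lt_of_lt_of_le one_pos (one_le_weight_univ z Λ Y)).ne'

/-- **The conditional Gibbs distribution is normalised**: `γ_Λ(𝒳 | X̄) = 1` for bounded `Λ`.
[cite: Richthammer2007, §3.3 (p. 7)] -/
theorem gibbsKernel_univ (z : ℝ) {Λ : Set (EuclideanSpace ℝ (Fin 2))}
    (hΛb : Bornology.IsBounded Λ) (Y : PointConfig (EuclideanSpace ℝ (Fin 2))) :
    gibbsKernel z Λ Y univ = 1 :=
  ENNReal.div_self (weight_univ_ne_zero z Λ Y) (weight_univ_ne_top z hΛb Y)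

/-- `weight z Λ X̄ ·` is monotone in the event. [folklore] -/
theorem weight_mono (z : ℝ) (Λ : Set (EuclideanSpace ℝ (Fin 2)))
    (Y : PointConfig (EuclideanSpace ℝ (Fin 2))) {A B : Set (PointConfig (EuclideanSpace ℝ (Fin 2)))}
    (h : A ⊆ B) : weight z Λ Y A ≤ weight z Λ Y B := by
  unfold weight
  refine ENNReal.tsum_le_tsum fun k => mul_le_mul' le_rfl (lintegral_mono fun x => ?_)
  exact Set.indicator_le_indicator_of_subset (Set.inter_subset_inter_left _ h)
    (fun _ => bot_le) _

/-- `γ_Λ(A | X̄) ≤ 1`. [cite: Richthammer2007, §3.3 (p. 7)] -/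
theorem gibbsKernel_le_one (z : ℝ) (Λ : Set (EuclideanSpace ℝ (Fin 2)))
    (Y : PointConfig (EuclideanSpace ℝ (Fin 2))) (A : Set (PointConfig (EuclideanSpace ℝ (Fin 2)))) :
    gibbsKernel z Λ Y A ≤ 1 := by
  unfold gibbsKernel
  refine ENNReal.div_le_of_le_mul ?_
  rw [one_mul]
  exact weight_mono z Λ Y (Set.subset_univ A)

/-! ### The Gibbs kernel as a Markov kernel; the DLR equation for functions -/

/-- **`γ_Λ` is a probability kernel and `μ ⊗ γ_Λ = μ` for Gibbs `μ`.** For every real `z` and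
bounded measurable `Λ` there is a Markov kernel `κ` on configurations with
`κ X̄ A = γ_Λ(A | X̄)` (`gibbsKernel`) on events, whose integral of a measurable `g ≥ 0` is
`(∑_k (z^k/k!) ∫_{Λ^k ∩ {hard core}} g(X_Λ X̄_{Λᶜ}) dx) / weight z Λ X̄ 𝒳`, and such that
`μ.bind κ = μ` for every Gibbs measure `μ` at activity `z`.
[cite: Richthammer2007, §3.3 (p. 7, "γ_Λ is a probability kernel" and the displayed equivalence)] -/
theorem exists_gibbs_kernel (z : ℝ) {Λ : Set (EuclideanSpace ℝ (Fin 2))} (hΛ : MeasurableSet Λ)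
    (hΛb : Bornology.IsBounded Λ) :
    ∃ κ : Kernel (PointConfig (EuclideanSpace ℝ (Fin 2))) (PointConfig (EuclideanSpace ℝ (Fin 2))),
      IsMarkovKernel κ ∧
      (∀ (Y : PointConfig (EuclideanSpace ℝ (Fin 2))) (A : Set (PointConfig (EuclideanSpace ℝ (Fin 2)))),
        MeasurableSet A → κ Y A = gibbsKernel z Λ Y A) ∧
      (∀ (Y : PointConfig (EuclideanSpace ℝ (Fin 2)))
        (g : PointConfig (EuclideanSpace ℝ (Fin 2)) → ℝ≥0∞), Measurable g →
        ∫⁻ X, g X ∂(κ Y) =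
          (∑' k : ℕ, ENNReal.ofReal (z ^ k / (Nat.factorial k)) *
            ∫⁻ x in {x | HardCoreIn Λ (superpose Λ x Y)}, g (superpose Λ x Y)
              ∂(Measure.pi fun _ : Fin k => (volume : Measure (EuclideanSpace ℝ (Fin 2))).restrict Λ)) /
            weight z Λ Y univ) ∧
      ∀ μ : Measure (PointConfig (EuclideanSpace ℝ (Fin 2))), IsGibbs z μ → μ.bind κ = μ := by
  -- the unnormalised measures and their normalisations
  set W : PointConfig (EuclideanSpace ℝ (Fin 2)) → Measure (PointConfig (EuclideanSpace ℝ (Fin 2))) :=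
    fun Y => Measure.sum (fun k : ℕ => ENNReal.ofReal (z ^ k / (Nat.factorial k)) •
      ((Measure.pi fun _ : Fin k => (volume : Measure (EuclideanSpace ℝ (Fin 2))).restrict Λ).restrict
        {x | HardCoreIn Λ (superpose Λ x Y)}).map (fun x => superpose Λ x Y)) with hW
  have hWA : ∀ Y A, MeasurableSet A → W Y A = weight z Λ Y A := fun Y A hA => by
    rw [hW, weight_eq_sum_map_apply z hΛ Y hA]
  set γ : PointConfig (EuclideanSpace ℝ (Fin 2)) → Measure (PointConfig (EuclideanSpace ℝ (Fin 2))) :=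
    fun Y => (weight z Λ Y univ)⁻¹ • W Y with hγ
  have hγA : ∀ Y A, MeasurableSet A → γ Y A = gibbsKernel z Λ Y A := fun Y A hA => by
    rw [hγ]
    simp only [Measure.smul_apply, smul_eq_mul]
    rw [hWA Y A hA, gibbsKernel, ENNReal.div_eq_inv_mul]
  have hmeas : Measurable γ :=
    Measure.measurable_of_measurable_coe γ fun A hA => by
      simp_rw [hγA _ A hA]
      exact measurable_gibbsKernel z hΛ hA
  let κ : Kernel (PointConfig (EuclideanSpace ℝ (Fin 2))) (PointConfig (EuclideanSpace ℝ (Fin 2))) :=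
    ⟨γ, hmeas⟩
  have hκ : ∀ Y, κ Y = γ Y := fun Y => rfl
  have hprob : IsMarkovKernel κ := ⟨fun Y => ⟨by rw [hκ, hγA Y _ MeasurableSet.univ,
    gibbsKernel_univ z hΛb Y]⟩⟩
  refine ⟨κ, hprob, fun Y A hA => by rw [hκ, hγA Y A hA], fun Y g hg => ?_, fun μ hμ => ?_⟩
  · rw [hκ, hγ]
    simp only []
    rw [lintegral_smul_measure, smul_eq_mul, hW, lintegral_sum_map z hΛ Y hg,
      ENNReal.div_eq_inv_mul]
  · ext A hA
    rw [Measure.bind_apply hA (Kernel.measurable κ).aemeasurable, hμ.2 Λ hΛ hΛb A hA]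
    exact lintegral_congr fun Y => by rw [hκ, hγA Y A hA]

/-- **Richthammer 2007, (3.1) for functions (hard-disc model).** For a Gibbs measure `μ` at
activity `z`, a bounded measurable `Λ` and a measurable `g : 𝒳 → [0, ∞]`,
`∫ μ(dX) g(X) = ∫ μ(dX̄) ∫ γ_Λ(dX | X̄) g(X)`, the inner integral being
`(∑_k (z^k/k!) ∫_{Λ^k ∩ {hard core}} g(X_Λ X̄_{Λᶜ}) dx) / weight z Λ X̄ 𝒳`.
[cite: Richthammer2007, §3.3 (3.1) (p. 7)] -/
theorem IsGibbs.lintegral_eq {z : ℝ} {μ : Measure (PointConfig (EuclideanSpace ℝ (Fin 2)))}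
    (hμ : IsGibbs z μ) {Λ : Set (EuclideanSpace ℝ (Fin 2))} (hΛ : MeasurableSet Λ)
    (hΛb : Bornology.IsBounded Λ) {g : PointConfig (EuclideanSpace ℝ (Fin 2)) → ℝ≥0∞}
    (hg : Measurable g) :
    ∫⁻ X, g X ∂μ = ∫⁻ Y, (∑' k : ℕ, ENNReal.ofReal (z ^ k / (Nat.factorial k)) *
        ∫⁻ x in {x | HardCoreIn Λ (superpose Λ x Y)}, g (superpose Λ x Y)
          ∂(Measure.pi fun _ : Fin k => (volume : Measure (EuclideanSpace ℝ (Fin 2))).restrict Λ)) /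
        weight z Λ Y univ ∂μ := by
  obtain ⟨κ, _, -, hκg, hbind⟩ := exists_gibbs_kernel z hΛ hΛb
  conv_lhs => rw [← hbind μ hμ]
  rw [Measure.lintegral_bind (Kernel.measurable κ).aemeasurable hg.aemeasurable]
  exact lintegral_congr fun Y => hκg Y g hg

/-! ### (3.2): the hard core holds almost surely -/

/-- The unnormalised weight of the event "hard core violated in `Λ`" vanishes identically.
[cite: Richthammer2007, §3.3 (3.2) (p. 7)] -/
theorem weight_setOf_not_hardCoreIn (z : ℝ) (Λ : Set (EuclideanSpace ℝ (Fin 2)))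
    (Y : PointConfig (EuclideanSpace ℝ (Fin 2))) :
    weight z Λ Y {X | ¬ HardCoreIn Λ X} = 0 := by
  unfold weight
  refine ENNReal.tsum_eq_zero.2 fun k => ?_
  have h0 : ∀ x : Fin k → EuclideanSpace ℝ (Fin 2),
      ({X | ¬ HardCoreIn Λ X} ∩ {X | HardCoreIn Λ X}).indicator
        (1 : PointConfig (EuclideanSpace ℝ (Fin 2)) → ℝ≥0∞) (superpose Λ x Y) = 0 := fun x => by
    rw [Set.indicator_of_notMem]
    exact fun h => h.1 h.2
  simp_rw [h0, lintegral_zero, mul_zero]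

/-- **Richthammer 2007, (3.2) (hard-disc model), in a fixed volume**: under a Gibbs measure the
hard-core constraint in a bounded measurable `Λ` is violated with probability `0`.
[cite: Richthammer2007, §3.3 (3.2) (p. 7)] -/
theorem IsGibbs.measure_not_hardCoreIn {z : ℝ} {μ : Measure (PointConfig (EuclideanSpace ℝ (Fin 2)))}
    (hμ : IsGibbs z μ) {Λ : Set (EuclideanSpace ℝ (Fin 2))} (hΛ : MeasurableSet Λ)
    (hΛb : Bornology.IsBounded Λ) :
    μ {X | ¬ HardCoreIn Λ X} = 0 := by
  have hm : MeasurableSet {X : PointConfig (EuclideanSpace ℝ (Fin 2)) | ¬ HardCoreIn Λ X} :=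
    (measurableSet_hardCoreIn hΛ).compl
  rw [hμ.2 Λ hΛ hΛb _ hm]
  refine (lintegral_eq_zero_iff (measurable_gibbsKernel z hΛ hm)).2
    (Filter.Eventually.of_forall fun Y => ?_)
  change weight z Λ Y {X | ¬ HardCoreIn Λ X} / weight z Λ Y univ = 0
  rw [weight_setOf_not_hardCoreIn, ENNReal.zero_div]

/-- **Richthammer 2007, (3.2) (hard-disc model)**: a Gibbs measure of the hard-disc model is
carried by hard-disc configurations, `μ({X : ∃ x ≠ x' ∈ X, |x - x'| ≤ 1}) = 0`.
[cite: Richthammer2007, §3.3 (3.2) (p. 7)] -/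
theorem IsGibbs.ae_isHardCore {z : ℝ} {μ : Measure (PointConfig (EuclideanSpace ℝ (Fin 2)))}
    (hμ : IsGibbs z μ) : ∀ᵐ X ∂μ, IsHardCore X := by
  rw [ae_iff]
  have hsub : {X : PointConfig (EuclideanSpace ℝ (Fin 2)) | ¬ IsHardCore X} ⊆
      ⋃ m : ℕ, {X | ¬ HardCoreIn (box m) X} := by
    intro X hX
    simp only [mem_setOf_eq, IsHardCore, not_forall, exists_prop] at hX
    obtain ⟨p, hp, q, hq, hpq, hd⟩ := hX
    obtain ⟨m, hm⟩ := exists_mem_box p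
    exact mem_iUnion.2 ⟨m, fun h => hd (h p hp q hq hpq (Or.inl hm))⟩
  refine measure_mono_null hsub (measure_iUnion_null fun m => ?_)
  exact hμ.measure_not_hardCoreIn (measurableSet_box m) (isBounded_box m)

end Literature.Barriers.AtomisticToContinuum.HardDisk

end
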